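import Literature.Probability.Percolation.TriPolyhexDisc
import Literature.Probability.Percolation.OneArmLSW
import HarnessLib

/-!
# Filling the holes of a finite set of sites of the triangular lattice

Topic `Literature/Probability/Percolation`; family `crit-perc`. The discrete counterpart of
taking the external boundary / filling the bounded complementary components of a planar set
(Bollobás–Riordan, *Percolation* (2006), Ch. 7 §7.2.5 p. 187: "`∂^∞(N_i)` … the boundary of the
infinite component of `ℂ ∖ N_i`"), used to make lattice approximations of a Jordan domain
hole-free, as required by `exists_isTriDisc_of_coconnected` (`TriPolyhexDisc.lean`):

* `fill S` — the sites not joined to a far site by a lattice path avoiding `S`: `S` together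
  with the holes of its complement; `mem_fill_iff`, `subset_fill`;
* `pathIn_compl_fill` — **the complement of `fill S` is connected**; `pathIn_fill` — the
  filling of a connected set is connected (`pathIn_fill_to`: a hole is joined to `S` inside
  the filling);
* `pathIn_far` — **outside a disc the lattice is connected**: sites with a large coordinate are
  joined by straight moves (`pathIn_straight`, `pathIn_straight_int`) keeping one large
  coordinate, hence staying outside the disc (`sq_fst_le_norm_sq` & co.);
  `pathIn_compl_farSite` — far sites are joined to the far site avoiding `S`.

## References

* B. Bollobás, O. Riordan, *Percolation*, Cambridge University Press (2006), Ch. 7 §7.2.5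
  p. 187.

## Mathlib / tree

Tree: `OneArmLSW.lean` (`norm_triEmbed_sq`, `norm_triEmbed_le_triNorm`), `TriangularLattice`
(`triBall`, `triNorm`), `TriPolyhexDisc.lean` (`PathIn.restrict_reachable`), `SitePaths.lean`.
-/

noncomputable section

open Literature.Probability.LatticeModels

namespace Literature.Probability.Percolation

/-- **Straight lattice moves**: `v, v + e_j, …, v + n e_j` is a lattice path inside any set
containing these sites. [folklore] -/
theorem pathIn_straight {A : Set (Site 2)} (v : Site 2) (j : Fin 6) (n : ℕ)
    (h : ∀ k : ℕ, k ≤ n → v + (k : ℤ) • triDir j ∈ A) : PathIn triGraph A v (v + (n : ℤ) • triDir j) := by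
  induction n with
  | zero => simpa using PathIn.refl (by simpa using h 0 le_rfl)
  | succ n ih =>
    have e : v + ((n + 1 : ℕ) : ℤ) • triDir j = v + (n : ℤ) • triDir j + triDir j := by
      push_cast; rw [add_smul, one_smul, add_assoc]
    rw [e]
    exact (ih fun k hk => h k (by omega)).tail (triGraph_adj_add_triDir _ j) (by rw [← e]; exact h _ le_rfl)

/-- Straight moves by an integer amount (negative amounts go the opposite way). [folklore] -/
theorem pathIn_straight_int {A : Set (Site 2)} (v : Site 2) (j : Fin 6) (t : ℤ)
    (h : ∀ s : ℤ, min 0 t ≤ s → s ≤ max 0 t → v + s • triDir j ∈ A) : PathIn triGraph A v (v + t • triDir j) := by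
  rcases le_or_gt 0 t with ht | ht
  · obtain ⟨n, rfl⟩ := Int.eq_ofNat_of_zero_le ht
    exact pathIn_straight v j n fun k hk => h k (by simp) (by simp; exact_mod_cast hk)
  · obtain ⟨n, hn⟩ := Int.eq_ofNat_of_zero_le (neg_nonneg.2 ht.le)
    have e : v + t • triDir j = v + (n : ℤ) • triDir (j + 3) := by
      rw [triDir_add_three, smul_neg, ← neg_smul, ← hn, neg_neg]
    rw [e]
    refine pathIn_straight v (j + 3) n fun k hk => ?_
    have := h (-(k : ℤ)) (by rw [min_eq_right ht.le]; omega) (by rw [max_eq_left ht.le]; omega)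
    rwa [triDir_add_three, smul_neg, ← neg_smul]

/-- The coordinates of a straight move along `e₀`. [folklore] -/
theorem add_smul_triDir_zero (v : Site 2) (s : ℤ) : (v + s • triDir 0) 0 = v 0 + s ∧ (v + s • triDir 0) 1 = v 1 := by
  simp [triDir]

/-- The coordinates of a straight move along `e₁`. [folklore] -/
theorem add_smul_triDir_one (v : Site 2) (s : ℤ) : (v + s • triDir 1) 0 = v 0 ∧ (v + s • triDir 1) 1 = v 1 + s := by
  simp [triDir]

/-- The coordinates of a straight move along `e₅ = (1, -1)`. [folklore] -/
theorem add_smul_triDir_five (v : Site 2) (s : ℤ) : (v + s • triDir 5) 0 = v 0 + s ∧ (v + s • triDir 5) 1 = v 1 - s := by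
  simp [triDir]; ring

/-- Norm bound from the second coordinate: `‖v‖² ≥ ¾ v₁²`. [folklore] -/
theorem sq_snd_le_norm_sq (v : Site 2) : (3 : ℝ) / 4 * (v 1 : ℝ) ^ 2 ≤ ‖triEmbed v‖ ^ 2 := by
  rw [norm_triEmbed_sq]; push_cast; nlinarith [sq_nonneg ((2 : ℝ) * v 0 + v 1)]

/-- Norm bound from the first coordinate: `‖v‖² ≥ ¾ v₀²`. [folklore] -/
theorem sq_fst_le_norm_sq (v : Site 2) : (3 : ℝ) / 4 * (v 0 : ℝ) ^ 2 ≤ ‖triEmbed v‖ ^ 2 := by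
  rw [norm_triEmbed_sq]; push_cast; nlinarith [sq_nonneg ((v 0 : ℝ) + 2 * v 1)]

/-- Norm bound from the sum of the coordinates: `‖v‖² ≥ ¾ (v₀ + v₁)²`. [folklore] -/
theorem sq_add_le_norm_sq (v : Site 2) : (3 : ℝ) / 4 * ((v 0 : ℝ) + v 1) ^ 2 ≤ ‖triEmbed v‖ ^ 2 := by
  rw [norm_triEmbed_sq]; push_cast; nlinarith [sq_nonneg ((v 0 : ℝ) - v 1)]

/-- A site one of whose three coordinates `v₀, v₁, v₀ + v₁` exceeds `2ρ/√3` in absolute value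
(here: `¾ c² > ρ²`) lies outside the disc of radius `ρ`. [folklore] -/
theorem lt_norm_of_sq_lt {ρ : ℝ} {v : Site 2} {c : ℝ} (hc : (3 : ℝ) / 4 * c ^ 2 ≤ ‖triEmbed v‖ ^ 2)
    (h : ρ ^ 2 < 3 / 4 * c ^ 2) : ρ < ‖triEmbed v‖ := by
  by_contra hle
  push Not at hle
  rcases le_or_gt 0 ρ with hρ | hρ
  · nlinarith [norm_nonneg (triEmbed v)]
  · linarith [norm_nonneg (triEmbed v)]

/-- **Outside a disc, the lattice is connected**: two sites each having a coordinate
`v₀, v₁` or `v₀ + v₁` of absolute value `> N`, where `ρ² < ¾ N²`, are joined by a lattice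
path all of whose sites lie outside the disc of radius `ρ` (straight moves along `e₀`, `e₁`
and `e₅`, each keeping one large coordinate fixed). [folklore] -/
theorem pathIn_far {ρ : ℝ} {N : ℕ} (hN : ρ ^ 2 < 3 / 4 * (N : ℝ) ^ 2) {x y : Site 2}
    (hx : (N : ℤ) < |x 0| ∨ (N : ℤ) < |x 1| ∨ (N : ℤ) < |x 0 + x 1|)
    (hy : (N : ℤ) < |y 0| ∨ (N : ℤ) < |y 1| ∨ (N : ℤ) < |y 0 + y 1|) :
    PathIn triGraph {v : Site 2 | ρ < ‖triEmbed v‖} x y := by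
  set A : Set (Site 2) := {v | ρ < ‖triEmbed v‖} with hA
  set L : ℤ := N + 1 with hL
  -- membership tests
  have mem0 : ∀ v : Site 2, (N : ℤ) < |v 0| → v ∈ A := fun v hv => by
    refine lt_norm_of_sq_lt (sq_fst_le_norm_sq v) (lt_of_lt_of_le hN ?_)
    have : (N : ℝ) ^ 2 ≤ (v 0 : ℝ) ^ 2 := by
      have h' : ((N : ℤ) : ℝ) < |((v 0 : ℤ) : ℝ)| := by exact_mod_cast hv
      push_cast at h'
      nlinarith [abs_nonneg ((v 0 : ℝ)), sq_abs ((v 0 : ℝ)), (Nat.cast_nonneg N : (0 : ℝ) ≤ N)]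
    nlinarith
  have mem1 : ∀ v : Site 2, (N : ℤ) < |v 1| → v ∈ A := fun v hv => by
    refine lt_norm_of_sq_lt (sq_snd_le_norm_sq v) (lt_of_lt_of_le hN ?_)
    have : (N : ℝ) ^ 2 ≤ (v 1 : ℝ) ^ 2 := by
      have h' : ((N : ℤ) : ℝ) < |((v 1 : ℤ) : ℝ)| := by exact_mod_cast hv
      push_cast at h'
      nlinarith [abs_nonneg ((v 1 : ℝ)), sq_abs ((v 1 : ℝ)), (Nat.cast_nonneg N : (0 : ℝ) ≤ N)]
    nlinarith
  have mem2 : ∀ v : Site 2, (N : ℤ) < |v 0 + v 1| → v ∈ A := fun v hv => by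
    refine lt_norm_of_sq_lt (sq_add_le_norm_sq v) (lt_of_lt_of_le hN ?_)
    have : (N : ℝ) ^ 2 ≤ ((v 0 : ℝ) + v 1) ^ 2 := by
      have h' : ((N : ℤ) : ℝ) < |((v 0 + v 1 : ℤ) : ℝ)| := by exact_mod_cast hv
      push_cast at h'
      nlinarith [abs_nonneg ((v 0 : ℝ) + v 1), sq_abs ((v 0 : ℝ) + v 1), (Nat.cast_nonneg N : (0 : ℝ) ≤ N)]
    nlinarith
  -- the common target `(L, L)`
  set T : Site 2 := fun i => ![L, L] i with hT
  -- from a site with `|v₁| > N`: along `e₀` to `v₀ = L`, then along `e₁` to `v₁ = L`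
  have route1 : ∀ v : Site 2, (N : ℤ) < |v 1| → PathIn triGraph A v T := by
    intro v hv
    have step1 : PathIn triGraph A v (v + (L - v 0) • triDir 0) :=
      pathIn_straight_int v 0 _ fun s _ _ => mem1 _ (by rw [(add_smul_triDir_zero v s).2]; exact hv)
    have hmid0 : (v + (L - v 0) • triDir 0) 0 = L := by rw [(add_smul_triDir_zero v _).1]; ring
    have hmid1 : (v + (L - v 0) • triDir 0) 1 = v 1 := (add_smul_triDir_zero v _).2
    have step2 : PathIn triGraph A (v + (L - v 0) • triDir 0) (v + (L - v 0) • triDir 0 + (L - v 1) • triDir 1) :=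
      pathIn_straight_int _ 1 _ fun s _ _ => mem0 _ (by
        rw [(add_smul_triDir_one _ s).1, hmid0, hL, abs_of_nonneg (by positivity)]; omega)
    have hend : v + (L - v 0) • triDir 0 + (L - v 1) • triDir 1 = T := by
      ext i; fin_cases i
      · show (v + (L - v 0) • triDir 0 + (L - v 1) • triDir 1) 0 = L
        rw [(add_smul_triDir_one _ _).1, hmid0]
      · show (v + (L - v 0) • triDir 0 + (L - v 1) • triDir 1) 1 = L
        rw [(add_smul_triDir_one _ _).2, hmid1]; ring
    rw [← hend]; exact step1.trans step2
  -- from a site with `|v₀| > N`: along `e₁` to `v₁ = L`, then `route1`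
  have route0 : ∀ v : Site 2, (N : ℤ) < |v 0| → PathIn triGraph A v T := by
    intro v hv
    have step1 : PathIn triGraph A v (v + (L - v 1) • triDir 1) :=
      pathIn_straight_int v 1 _ fun s _ _ => mem0 _ (by rw [(add_smul_triDir_one v s).1]; exact hv)
    refine step1.trans (route1 _ ?_)
    rw [(add_smul_triDir_one v _).2, show v 1 + (L - v 1) = L by ring, hL, abs_of_nonneg (by positivity)]; omega
  -- from a site with `|v₀ + v₁| > N`: along `e₅` to `v₀ = L`, then `route0`
  have route2 : ∀ v : Site 2, (N : ℤ) < |v 0 + v 1| → PathIn triGraph A v T := by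
    intro v hv
    have step1 : PathIn triGraph A v (v + (L - v 0) • triDir 5) :=
      pathIn_straight_int v 5 _ fun s _ _ => mem2 _ (by
        rw [(add_smul_triDir_five v s).1, (add_smul_triDir_five v s).2, show v 0 + s + (v 1 - s) = v 0 + v 1 by ring]
        exact hv)
    refine step1.trans (route0 _ ?_)
    rw [(add_smul_triDir_five v _).1, show v 0 + (L - v 0) = L by ring, hL, abs_of_nonneg (by positivity)]; omega
  have toT : ∀ v : Site 2, ((N : ℤ) < |v 0| ∨ (N : ℤ) < |v 1| ∨ (N : ℤ) < |v 0 + v 1|) → PathIn triGraph A v T := by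
    rintro v (h | h | h)
    · exact route0 v h
    · exact route1 v h
    · exact route2 v h
  exact (toT x hx).trans (toT y hy).symm

/-! ### Filling the holes of a finite set of sites -/

open Finset

/-- A radius `N` with `K² < ¾ N²` for the hexagonal radius `K` of `S`: sites with a coordinate
beyond `N` are far from `S`. [folklore] -/
def frameRad (S : Finset (Site 2)) : ℕ := 2 * S.sup (fun v => (triNorm v).toNat) + 1

/-- A far site, to which the outside of `S` is anchored. [folklore] -/
def farSite (S : Finset (Site 2)) : Site 2 := fun i => ![(frameRad S : ℤ) + 1, 0] i

/-- **The filling of a finite set of sites**: the sites not joined to the far site by a lattice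
path avoiding `S` — `S` together with the bounded components ("holes") of its complement. It
lies in the hexagonal ball of radius `frameRad S`. [folklore] -/
def fill (S : Finset (Site 2)) : Finset (Site 2) :=
  open Classical in
  (triBall (frameRad S)).filter fun x => ¬ PathIn triGraph ((↑S : Set (Site 2))ᶜ) x (farSite S)

/-- Sites of `S` have hexagonal norm at most the radius of `S`. [folklore] -/
theorem triNorm_le_of_mem {S : Finset (Site 2)} {v : Site 2} (hv : v ∈ S) :
    triNorm v ≤ S.sup (fun v => (triNorm v).toNat) := by
  have h1 : (triNorm v).toNat ≤ S.sup (fun v => (triNorm v).toNat) := le_sup (f := fun v => (triNorm v).toNat) hv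
  have h2 : triNorm v = ((triNorm v).toNat : ℤ) := (Int.toNat_of_nonneg (triNorm_nonneg v)).symm
  omega

/-- **Far sites are joined to the far site avoiding `S`.** [folklore] -/
theorem pathIn_compl_farSite {S : Finset (Site 2)} {x : Site 2}
    (hx : (frameRad S : ℤ) < |x 0| ∨ (frameRad S : ℤ) < |x 1| ∨ (frameRad S : ℤ) < |x 0 + x 1|) :
    PathIn triGraph ((↑S : Set (Site 2))ᶜ) x (farSite S) := by
  set K := S.sup (fun v => (triNorm v).toNat) with hK
  have hN : ((K : ℝ)) ^ 2 < 3 / 4 * ((frameRad S : ℕ) : ℝ) ^ 2 := by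
    rw [frameRad, ← hK]; push_cast; nlinarith [(Nat.cast_nonneg K : (0 : ℝ) ≤ K)]
  have hfar : (frameRad S : ℤ) < |farSite S 0| ∨ (frameRad S : ℤ) < |farSite S 1| ∨
      (frameRad S : ℤ) < |farSite S 0 + farSite S 1| := by
    left; simp only [farSite, Matrix.cons_val_zero]; rw [abs_of_nonneg (by positivity)]; omega
  refine (pathIn_far hN hx hfar).mono fun v hv hvS => ?_
  -- sites of `S` lie in the disc of radius `K`
  have h1 : ‖triEmbed v‖ ≤ (triNorm v : ℝ) := norm_triEmbed_le_triNorm v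
  have h2 : (triNorm v : ℝ) ≤ K := by exact_mod_cast triNorm_le_of_mem (mem_coe.1 hvS)
  exact absurd hv (not_lt.2 (h1.trans h2))

/-- Sites outside the frame ball are far. [folklore] -/
theorem far_of_not_mem_triBall {S : Finset (Site 2)} {x : Site 2} (hx : x ∉ triBall (frameRad S)) :
    (frameRad S : ℤ) < |x 0| ∨ (frameRad S : ℤ) < |x 1| ∨ (frameRad S : ℤ) < |x 0 + x 1| := by
  rw [mem_triBall_iff, not_le] at hx
  unfold triNorm at hx
  rcases lt_max_iff.1 hx with h | h
  · exact Or.inl h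
  · rcases lt_max_iff.1 h with h | h
    · exact Or.inr (Or.inl h)
    · exact Or.inr (Or.inr h)

/-- **Characterisation of the filling**: a site is in `fill S` iff it is not joined to the far
site avoiding `S`. [folklore] -/
theorem mem_fill_iff {S : Finset (Site 2)} {x : Site 2} :
    x ∈ fill S ↔ ¬ PathIn triGraph ((↑S : Set (Site 2))ᶜ) x (farSite S) := by
  classical
  rw [fill, mem_filter]
  constructor
  · exact fun h => h.2
  · intro h
    refine ⟨?_, h⟩
    by_contra hx
    exact h (pathIn_compl_farSite (far_of_not_mem_triBall hx))

/-- `S ⊆ fill S`. [folklore] -/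
theorem subset_fill (S : Finset (Site 2)) : S ⊆ fill S := fun _ hx =>
  mem_fill_iff.2 fun h => h.left_mem (mem_coe.2 hx)

/-- **The complement of the filling is connected** (everything hangs on the far site). [folklore] -/
theorem pathIn_compl_fill {S : Finset (Site 2)} {o o' : Site 2} (ho : o ∉ fill S) (ho' : o' ∉ fill S) :
    PathIn triGraph ((↑(fill S) : Set (Site 2))ᶜ) o o' := by
  have key : ∀ o, o ∉ fill S → PathIn triGraph ((↑(fill S) : Set (Site 2))ᶜ) (farSite S) o := by
    intro o ho
    rw [mem_fill_iff, not_not] at ho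
    refine ho.symm.restrict_reachable.mono fun v hv => ?_
    intro hv'
    exact (mem_fill_iff.1 (mem_coe.1 hv')) hv.symm
  exact (key o ho).symm.trans (key o' ho')

/-- **The filling of a connected set is connected**: a hole is joined, inside the filling, to
`S` — its site maximising `2x₀ + x₁` has the neighbour `· + e₀` in `S`. [folklore] -/
theorem pathIn_fill_to {S : Finset (Site 2)} {h : Site 2} (hh : h ∈ fill S) (hhS : h ∉ S) :
    ∃ s ∈ S, PathIn triGraph (↑(fill S) : Set (Site 2)) h s := by
  classical
  -- the component of `h` in the complement of `S`, a subset of the filling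
  set H := (fill S).filter fun v => PathIn triGraph ((↑S : Set (Site 2))ᶜ) h v with hH
  have hHfill : ∀ v, PathIn triGraph ((↑S : Set (Site 2))ᶜ) h v → v ∈ fill S := fun v hv =>
    mem_fill_iff.2 fun hv' => (mem_fill_iff.1 hh) (hv.trans hv')
  have hhH : h ∈ H := mem_filter.2 ⟨hh, PathIn.refl (fun h' => hhS (mem_coe.1 h'))⟩
  obtain ⟨v, hv, hvmax⟩ := exists_max_image H (fun z : Site 2 => 2 * z 0 + z 1) ⟨h, hhH⟩
  obtain ⟨-, hvpath⟩ := mem_filter.1 hv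
  -- `v + e₀` is not in the component, hence in `S`
  have hv0 : v + triDir 0 ∈ S := by
    by_contra hnS
    have hreach : PathIn triGraph ((↑S : Set (Site 2))ᶜ) h (v + triDir 0) :=
      hvpath.tail (triGraph_adj_add_triDir v 0) (fun h' => hnS (mem_coe.1 h'))
    have := hvmax _ (mem_filter.2 ⟨hHfill _ hreach, hreach⟩)
    simp [triDir] at this
  refine ⟨v + triDir 0, hv0, ?_⟩
  have h1 : PathIn triGraph (↑(fill S) : Set (Site 2)) h v :=
    hvpath.restrict_reachable.mono fun z hz => mem_coe.2 (hHfill z hz)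
  exact h1.tail (triGraph_adj_add_triDir v 0) (mem_coe.2 (subset_fill S hv0))

/-- The filling of a connected set is connected. [folklore] -/
theorem pathIn_fill {S : Finset (Site 2)} (hconn : ∀ p ∈ S, ∀ q ∈ S, PathIn triGraph (↑S : Set (Site 2)) p q)
    {x y : Site 2} (hx : x ∈ fill S) (hy : y ∈ fill S) : PathIn triGraph (↑(fill S) : Set (Site 2)) x y := by
  have hsub : (↑S : Set (Site 2)) ⊆ (↑(fill S) : Set (Site 2)) := fun v hv => mem_coe.2 (subset_fill S (mem_coe.1 hv))
  have key : ∀ x ∈ fill S, ∃ s ∈ S, PathIn triGraph (↑(fill S) : Set (Site 2)) x s := by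
    intro x hx
    by_cases hxS : x ∈ S
    · exact ⟨x, hxS, PathIn.refl (mem_coe.2 hx)⟩
    · exact pathIn_fill_to hx hxS
  obtain ⟨s, hs, hxs⟩ := key x hx
  obtain ⟨t, ht, hyt⟩ := key y hy
  exact (hxs.trans ((hconn s hs t ht).mono hsub)).trans hyt.symm

end Literature.Probability.Percolation
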